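import Summits.CriticalPhenomena.PercolationContinuityZ3.Theorems.PercNearOneGluingNoHeavyLowerTailSahiColouredDaykin
import Mathlib.Tactic
import HarnessLib

/-!
# `NoHeavyLowerTail` (crux stmt-CriticalPhenomena-4575), master-family line P1 (gen 27):
# signed coloured Daykin — the TWO-COLOUR case (Daykin after re-signing) and the unconditional "two of three" bound

Support file (seat `prim-masterthm-p1`, gen 27; `--supports stmt-CriticalPhenomena-4575`).  No new definitions, no `sorry`, standard axioms.
Continues `…SahiColouredDaykin` (p393233): there `SignedColouredDaykin3` is the typed conjecture "`#P ≤ #compatJoins F P c`" for a family `P ⊆ 2^F`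
with no complementary pair and a 3-colouring `c`, and the one-colour case is proved (Daykin).  Memo
`run/shared/lean/prim/prim-masterthm/FROM-prim-masterthm-p1-g27-COLOURED-DAYKIN.md` §3.

NEW HERE (gen 27, [this work]).
* `card_le_card_compatJoins_of_ne` — **two colours: THEOREM.**  If the colouring avoids one colour `a` then `#P ≤ #compatJoins F P c`.  PROOF (memo §3):
  with the two remaining colour classes `A, B` put `Q = A ∪ B̃`, `Q' = Ã ∪ B` (`X̃ = {F ∖ S : S ∈ X}`); "compatible" (same colour & opposite sides, or different
  colours & same side) becomes "one factor in `Q`, the other in `Q'`", so `Q ∨ Q' ⊆ compatJoins`, and `Q ∧ Q'` is the complement image of `Q' ∨ Q`; Daykin's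
  `|Q||Q'| ≤ |Q ∨ Q'||Q ∧ Q'|` (Mathlib `Finset.le_card_infs_mul_card_sups`) with `|Q| = |Q'| = |P|` (no complementary pair) gives the claim.  For THREE colours no
  re-signing makes every compatible pair opposite-sided (a triangle is not bipartite) — that is the open `SignedColouredDaykin3`.
* `compatJoins_mono` and **`card_sub_card_filter_le_card_compatJoins` — "two of three", unconditional:** for every colour `a`,
  `#P − #{S ∈ P : c S = a} ≤ #compatJoins F P c`; hence `2·#P ≤ 3·#compatJoins` (`two_mul_card_le_three_mul_card_compatJoins`).  Through the reduction of
  p393233 this is the unconditional statement that in every sub-cube the (cross-join, cross-meet) antipodal pairs are at least the antipodal cross pairs avoiding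
  any one fixed cyclic type.
HONEST FRAMING: elementary; the three-colour statement stays OPEN. [this work]
-/

namespace Summit.CriticalPhenomena.PercolationContinuityZ3.Theorems.SahiColouredDaykin

open Finset
open scoped FinsetFamily

variable {α : Type*} [DecidableEq α]

/-- For `S, S' ⊆ F`: `F ∖ ((F ∖ S) ∪ (F ∖ S')) = S ∩ S'`. [folklore] -/
private theorem sdiff_sdiff_union_sdiff {F S S' : Finset α} (hS : S ⊆ F) (hS' : S' ⊆ F) :
    F \ ((F \ S) ∪ (F \ S')) = S ∩ S' := by
  ext a
  have h1 : a ∈ S → a ∈ F := fun h => hS h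
  have h2 : a ∈ S' → a ∈ F := fun h => hS' h
  simp only [mem_sdiff, mem_union, mem_inter]
  tauto

/-- In `Fin 3`, two values avoiding the same two distinct values coincide. [folklore] -/
private theorem fin3_eq_of_ne_ne {x y a b : Fin 3} (hab : a ≠ b) (hxa : x ≠ a) (hxb : x ≠ b) (hya : y ≠ a) (hyb : y ≠ b) :
    x = y := by
  revert x y a b; decide

/-- **Monotonicity**: enlarging `P` enlarges the compatible unions. [this work] -/
theorem compatJoins_mono (F : Finset α) {P P' : Finset (Finset α)} (h : P' ⊆ P) (c : Finset α → Fin 3) :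
    compatJoins F P' c ⊆ compatJoins F P c := by
  intro T hT
  simp only [compatJoins, mem_union, mem_image, mem_filter, mem_product, Prod.exists] at hT ⊢
  rcases hT with (⟨S, S', ⟨⟨hS, hS'⟩, hc⟩, rfl⟩ | ⟨S, S', ⟨⟨hS, hS'⟩, hc⟩, rfl⟩) | ⟨S, S', ⟨⟨hS, hS'⟩, hc⟩, rfl⟩
  · exact Or.inl (Or.inl ⟨S, S', ⟨⟨h hS, h hS'⟩, hc⟩, rfl⟩)
  · exact Or.inl (Or.inr ⟨S, S', ⟨⟨h hS, h hS'⟩, hc⟩, rfl⟩)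
  · exact Or.inr ⟨S, S', ⟨⟨h hS, h hS'⟩, hc⟩, rfl⟩

/-- **Two colours: Daykin after re-signing.**  If `P ⊆ 2^F` has no complementary pair and its colouring avoids the colour `a`, then
`#P ≤ #compatJoins F P c`. [this work] -/
theorem card_le_card_compatJoins_of_ne (F : Finset α) (P : Finset (Finset α)) (c : Finset α → Fin 3) (a : Fin 3)
    (hPF : ∀ S ∈ P, S ⊆ F) (htr : ∀ S ∈ P, F \ S ∉ P) (ha : ∀ S ∈ P, c S ≠ a) :
    #P ≤ #(compatJoins F P c) := by
  set J := compatJoins F P c with hJ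
  set cpl : Finset α → Finset α := fun S => F \ S with hcpl
  -- the other two colours: `b = a + 1` and the third one
  set b : Fin 3 := a + 1 with hb
  have hab : a ≠ b := by
    rw [hb]
    have : ∀ x : Fin 3, x ≠ x + 1 := by decide
    exact this a
  set A := P.filter fun S => c S = b with hA
  set B := P.filter fun S => c S ≠ b with hB
  have hAP : A ⊆ P := filter_subset _ _
  have hBP : B ⊆ P := filter_subset _ _
  have memA : ∀ {S}, S ∈ A → S ∈ P ∧ c S = b := fun {S} h => mem_filter.1 h
  have memB : ∀ {S}, S ∈ B → S ∈ P ∧ c S ≠ b := fun {S} h => mem_filter.1 h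
  -- two members of `B` have the same colour (both avoid `a` and `b`)
  have colB : ∀ {S T}, S ∈ B → T ∈ B → c S = c T := fun {S T} hS hT =>
    fin3_eq_of_ne_ne hab (ha S (memB hS).1) (memB hS).2 (ha T (memB hT).1) (memB hT).2
  have colAB : ∀ {S T}, S ∈ A → T ∈ B → c S ≠ c T := fun {S T} hS hT h =>
    (memB hT).2 (h.symm.trans (memA hS).2)
  set Q := A ∪ B.image cpl with hQ
  set Q' := A.image cpl ∪ B with hQ'
  have cplcpl : ∀ {S}, S ∈ P → cpl (cpl S) = S := fun {S} hS => by
    show F \ (F \ S) = S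
    exact Finset.sdiff_sdiff_eq_self (hPF S hS)
  -- complements of `Q` lie in `Q'` and vice versa
  have cplQ : ∀ {S}, S ∈ Q → cpl S ∈ Q' := by
    intro S hS
    rcases mem_union.1 hS with hS | hS
    · exact mem_union.2 (Or.inl (mem_image.2 ⟨S, hS, rfl⟩))
    · obtain ⟨T, hT, rfl⟩ := mem_image.1 hS
      rw [cplcpl (memB hT).1]
      exact mem_union.2 (Or.inr hT)
  have cplQ' : ∀ {S}, S ∈ Q' → cpl S ∈ Q := by
    intro S hS
    rcases mem_union.1 hS with hS | hS
    · obtain ⟨T, hT, rfl⟩ := mem_image.1 hS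
      rw [cplcpl (memA hT).1]
      exact mem_union.2 (Or.inl hT)
    · exact mem_union.2 (Or.inr (mem_image.2 ⟨S, hS, rfl⟩))
  have subQ : ∀ {S}, S ∈ Q → S ⊆ F := by
    intro S hS
    rcases mem_union.1 hS with hS | hS
    · exact hPF S (memA hS).1
    · obtain ⟨T, _, rfl⟩ := mem_image.1 hS
      exact sdiff_subset
  have subQ' : ∀ {S}, S ∈ Q' → S ⊆ F := by
    intro S hS
    rcases mem_union.1 hS with hS | hS
    · obtain ⟨T, _, rfl⟩ := mem_image.1 hS
      exact sdiff_subset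
    · exact hPF S (memB hS).1
  -- (1) sups are compatible unions
  have hsup : Q ⊻ Q' ⊆ J := by
    intro X hX
    obtain ⟨S, hS, S', hS', rfl⟩ := mem_sups.1 hX
    rcases mem_union.1 hS with hSA | hSB
    · rcases mem_union.1 hS' with hS'A | hS'B
      · -- A ∨ Ã : same colour, opposite sides
        obtain ⟨T, hTA, rfl⟩ := mem_image.1 hS'A
        exact union_sdiff_mem_compatJoins (memA hSA).1 (memA hTA).1 ((memA hSA).2.trans (memA hTA).2.symm)
      · -- A ∨ B : different colours, both positive
        exact union_mem_compatJoins (memA hSA).1 (memB hS'B).1 (colAB hSA hS'B)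
    · obtain ⟨T, hTB, rfl⟩ := mem_image.1 hSB
      rcases mem_union.1 hS' with hS'A | hS'B
      · -- B̃ ∨ Ã : different colours, both negative
        obtain ⟨T', hT'A, rfl⟩ := mem_image.1 hS'A
        exact sdiff_union_sdiff_mem_compatJoins (F := F) (memB hTB).1 (memA hT'A).1 (fun e => colAB hT'A hTB e.symm)
      · -- B̃ ∨ B : same colour, opposite sides
        have h := union_sdiff_mem_compatJoins (F := F) (memB hS'B).1 (memB hTB).1 (colB hS'B hTB)
        rw [union_comm] at h
        exact h
  -- (2) infs are complements of compatible unions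
  have hinf : Q ⊼ Q' ⊆ J.image cpl := by
    intro T hT
    obtain ⟨S, hS, S', hS', rfl⟩ := mem_infs.1 hT
    have hmem : cpl S' ∪ cpl S ∈ J := by
      have : cpl S' ⊔ cpl S ∈ Q ⊻ Q' := mem_sups.2 ⟨cpl S', cplQ' hS', cpl S, cplQ hS, rfl⟩
      exact hsup this
    refine mem_image.2 ⟨cpl S' ∪ cpl S, hmem, ?_⟩
    show F \ ((F \ S') ∪ (F \ S)) = S ⊓ S'
    rw [sdiff_sdiff_union_sdiff (subQ' hS') (subQ hS), inter_comm]
    rfl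
  -- (3) cardinalities
  have hcplinjP : Set.InjOn cpl ↑P := by
    intro S hS S' hS' h
    have e1 := cplcpl (mem_coe.1 hS)
    have e2 := cplcpl (mem_coe.1 hS')
    rw [← e1, ← e2]
    exact congrArg cpl h
  have hcardBimg : #(B.image cpl) = #B := card_image_of_injOn (hcplinjP.mono (coe_subset.2 hBP))
  have hcardAimg : #(A.image cpl) = #A := card_image_of_injOn (hcplinjP.mono (coe_subset.2 hAP))
  have hdisj : Disjoint A (B.image cpl) := by
    rw [disjoint_left]
    intro S hSA hSB
    obtain ⟨T, hT, rfl⟩ := mem_image.1 hSB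
    exact htr T (memB hT).1 (memA hSA).1
  have hdisj' : Disjoint (A.image cpl) B := by
    rw [disjoint_left]
    intro S hSA hSB
    obtain ⟨T, hT, rfl⟩ := mem_image.1 hSA
    exact htr T (memA hT).1 (memB hSB).1
  have hAB : #A + #B = #P := Finset.card_filter_add_card_filter_not (fun S => c S = b)
  have hcardQ : #Q = #P := by rw [hQ, card_union_of_disjoint hdisj, hcardBimg, hAB]
  have hcardQ' : #Q' = #P := by rw [hQ', card_union_of_disjoint hdisj', hcardAimg, hAB]
  have hday := Finset.le_card_infs_mul_card_sups Q Q'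
  have h1 : #(Q ⊻ Q') ≤ #J := card_le_card hsup
  have h2 : #(Q ⊼ Q') ≤ #J := (card_le_card hinf).trans card_image_le
  have hsq : #P * #P ≤ #J * #J := by
    calc #P * #P = #Q * #Q' := by rw [hcardQ, hcardQ']
      _ ≤ #(Q ⊼ Q') * #(Q ⊻ Q') := hday
      _ ≤ #J * #J := Nat.mul_le_mul h2 h1
  exact Nat.mul_self_le_mul_self_iff.1 hsq

/-- **"Two of three" (unconditional).**  For every colour `a`: `#P − #{S ∈ P : c S = a} ≤ #compatJoins F P c` — apply the two-colour theorem to the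
sub-family avoiding `a` and monotonicity. [this work] -/
theorem card_sub_card_filter_le_card_compatJoins (F : Finset α) (P : Finset (Finset α)) (c : Finset α → Fin 3) (a : Fin 3)
    (hPF : ∀ S ∈ P, S ⊆ F) (htr : ∀ S ∈ P, F \ S ∉ P) :
    #P - #(P.filter fun S => c S = a) ≤ #(compatJoins F P c) := by
  set P' := P.filter fun S => ¬ c S = a with hP'
  have hP'P : P' ⊆ P := filter_subset _ _
  have hsum : #(P.filter fun S => c S = a) + #P' = #P := Finset.card_filter_add_card_filter_not (fun S => c S = a)
  have hcard : #P - #(P.filter fun S => c S = a) = #P' := by omega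
  rw [hcard]
  have h2 : #P' ≤ #(compatJoins F P' c) :=
    card_le_card_compatJoins_of_ne F P' c a (fun S hS => hPF S (hP'P hS))
      (fun S hS hS' => htr S (hP'P hS) (hP'P hS')) (fun S hS => (mem_filter.1 hS).2)
  exact h2.trans (card_le_card (compatJoins_mono F hP'P c))

/-- **Corollary: `2·#P ≤ 3·#compatJoins`** (sum the three "two of three" bounds over the colours). [this work] -/
theorem two_mul_card_le_three_mul_card_compatJoins (F : Finset α) (P : Finset (Finset α)) (c : Finset α → Fin 3)
    (hPF : ∀ S ∈ P, S ⊆ F) (htr : ∀ S ∈ P, F \ S ∉ P) :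
    2 * #P ≤ 3 * #(compatJoins F P c) := by
  have h0 := card_sub_card_filter_le_card_compatJoins F P c 0 hPF htr
  have h1 := card_sub_card_filter_le_card_compatJoins F P c 1 hPF htr
  have h2 := card_sub_card_filter_le_card_compatJoins F P c 2 hPF htr
  -- the three colour classes partition `P`
  have e0 : #(P.filter fun S => c S = 0) + #(P.filter fun S => ¬ c S = 0) = #P :=
    Finset.card_filter_add_card_filter_not (fun S => c S = 0)
  have e1 : #((P.filter fun S => ¬ c S = 0).filter fun S => c S = 1)
      + #((P.filter fun S => ¬ c S = 0).filter fun S => ¬ c S = 1) = #(P.filter fun S => ¬ c S = 0) :=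
    Finset.card_filter_add_card_filter_not (fun S => c S = 1)
  have f1 : ((P.filter fun S => ¬ c S = 0).filter fun S => c S = 1) = P.filter fun S => c S = 1 := by
    ext S
    simp only [mem_filter]
    constructor
    · rintro ⟨⟨hS, _⟩, h⟩; exact ⟨hS, h⟩
    · rintro ⟨hS, h⟩
      refine ⟨⟨hS, ?_⟩, h⟩
      rw [h]; decide
  have f2 : ((P.filter fun S => ¬ c S = 0).filter fun S => ¬ c S = 1) = P.filter fun S => c S = 2 := by
    ext S
    simp only [mem_filter]
    constructor
    · rintro ⟨⟨hS, h0⟩, h1⟩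
      refine ⟨hS, ?_⟩
      have : ∀ x : Fin 3, ¬ x = 0 → ¬ x = 1 → x = 2 := by decide
      exact this _ h0 h1
    · rintro ⟨hS, h⟩
      refine ⟨⟨hS, ?_⟩, ?_⟩
      · rw [h]; decide
      · rw [h]; decide
  rw [f1, f2] at e1
  omega

end Summit.CriticalPhenomena.PercolationContinuityZ3.Theorems.SahiColouredDaykin
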